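import Summits.BirchSwinnertonDyer.Rank1Residual.AdditivePotMult.ClassTheorems
import Summits.BirchSwinnertonDyer.Rank1Residual.AdditivePotMult.OneSided
import Summits.BirchSwinnertonDyer.Rank1Residual.X5.TwoAdicTargets
import Literature.NumberTheory.EllipticCurves.BSDSelmerPConverseProofs
import HarnessLib

/-!
# ROUTE-L2 (lens «around», ADDITIVE 2): companion sketch — the quadratic door at `p = 2`
# (BSD₂ form and rank-0/1 2-CONVERSE form), and the typed wall for semistability defect `e ≥ 3`

Cell `bsd-2adic` (run/shared/lean/pub/bsd-2adic/, HUMAN RULING D-0036), seat `bsd-2adic-addL2`,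
memo `HOME/memos/ROUTE-L2.md`. HONEST FRAMING: this file TYPES the base-change-and-descend road for
the 1 945 additive-at-2 residue classes of O1 (`X5.O1.CellAddv`) and PROVES only bookkeeping
reductions; every arithmetic input at `2` is a displayed hypothesis (`def … : Prop`, nothing
asserted). Nothing here is a door with a printed far side: the located gaps are §2 `hK`
(`MissingPPartOverAt W' 2` for a curve over a quadratic field in which `2` RAMIFIES, semistable at
the prime above `2`) and §3 `TwoConverseOverAt` (the corank-`r` 2-converse for the same curves);
NO published theorem reaches either (memo §5: Kato 2004 §§12–17 print `p ≠ 2` in every integral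
clause; Skinner–Urban 2014 / BSTW 2024 / CGLS / Castella: `p` odd; Kriz–Li 2019: `p = 2` SPLIT in
`K`; Kriz 2020v5 Thm. 10.13 / Fan–Wan 2023: CM only, unrefereed; W. Zhang 2014, BST 2021: `p ≥ 5`).

## Census behind the sub-partition (kit job j239581, EVIDENCE; memo §1)

`Φ(E,2) = ρ_{E,ℓ}(I₂) ⊂ SL₂(𝔽₃)` on the 1 945 additive-at-2 X5 residue classes of book230:
pot. mult. 463 · `C₂` 100 · `C₃` 454 · `C₄` 18 · `C₆` 147 · `Q₈` 189 · `SL₂(𝔽₃)` 574; quadratic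
sub-class 563 (partner already PROVED for 424), odd core 601, 2-power core 781.

## Contents
§1 `QuadSemistabilisable W` ⊇ `PotMult W 2` (PROVED) and `DefectAtLeastThree`; §2 door L2-Q, BSD₂ form = `AdditivePotMult.bsdp_of_pPartOver_of_bsdp_twist'` READ AT `p = 2`
(Milne 1972 Thm. 1 + Cassels + Artin formalism; no parity hypothesis in that kernel chain);
§2b NEW pair theorem (any `p`): exactness over `K` + the two upper halves over `ℚ` ⟹ the `p`-part
for `W` AND `Wd`; §3 NEW converse doors L2-Q′ / L2-odd′, uniform in an admissibility predicate at
`2`: (b_P) Friedberg–Hoffstein field + (c) Kato Cor. 14.3 at `2` + (d) DD 2010 Lemma 4.14 +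
(f) modularity + the ONE typed input `TwoConverseOverAt W K r` ⟹ `selmerCorank 2 = r → analyticRank
= r` (PROVED assembly, no parity input); §4 the typed wall for the 2-power core.
-/

noncomputable section

open scoped Classical

open WeierstrassCurve Literature.NumberTheory.EllipticCurves
  Literature.NumberTheory.EllipticCurves.Rank1Residual
  Literature.NumberTheory.EllipticCurves.Rank1Residual.Typed
  Summit.BirchSwinnertonDyer.Rank1Residual.AdditivePotMult

namespace Summit.BirchSwinnertonDyer.Rank1Residual.X5.AddTwoL2

/-! ## §1 The quadratic sub-class of the additive cell at `2` -/

section SubClass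

variable (W : WeierstrassCurve ℚ) [W.IsElliptic]

/-- **Quadratically semistabilisable at `2`**: some quadratic twist `E^{(d)}`, `d ∈ ℚ^×`, has good
or multiplicative reduction at `2`. For an additive `E` this says: the semistability defect
`Φ(E,2)` is `C₂` (then `E^{(d)}` is GOOD at `2`, `d ∈ {-1, ±2}` up to squares and the unramified
class) or `E` is potentially multiplicative (then `E^{(d)}` is a Tate curve at `2`). Census
(j239581): 100 + 463 = 563 of the 1 945 additive-at-2 residue classes. A predicate; nothing
asserted. [folklore] -/
def QuadSemistabilisable : Prop :=
  ∃ d : ℚ, d ≠ 0 ∧ (Good (W.quadraticTwist d) 2 ∨ Mult (W.quadraticTwist d) 2)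

/-- Potentially multiplicative at `2` ⟹ quadratically semistabilisable at `2` (the tree's
`PotMult.exists_twist_mult`, Silverman *ATAEC* V.5.3, valid at `p = 2`). [folklore] -/
theorem quadSemistabilisable_of_potMult (h : PotMult W 2) : QuadSemistabilisable W := by
  obtain ⟨d, hd, hm⟩ := h.exists_twist_mult
  exact ⟨d, hd, Or.inr hm⟩

/-- **Semistability defect at least `3`**: additive at `2` and NOT quadratically semistabilisable,
i.e. `Φ(E,2) ∈ {C₃, C₄, C₆, Q₈, SL₂(𝔽₃)}` (census: 454 + 18 + 147 + 189 + 574 = 1 382 classes).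
A predicate; nothing asserted. [folklore] -/
def DefectAtLeastThree : Prop := Addv W 2 ∧ ¬ QuadSemistabilisable W

omit [W.IsElliptic] in
/-- The additive cell at `2` splits into the quadratic sub-class and the defect-`≥ 3` sub-class
(pure logic). [folklore] -/
theorem cellAddv_split [W.IsGloballyMinimal] (h : O1.CellAddv W) :
    QuadSemistabilisable W ∨ DefectAtLeastThree W := by
  by_cases hq : QuadSemistabilisable W
  · exact Or.inl hq
  · exact Or.inr ⟨h, hq⟩

end SubClass

/-! ## §2 Door L2-Q, BSD₂ form: base change to the semistabilising quadratic field and descend -/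

section DoorBSD

variable (W : WeierstrassCurve ℚ) [W.IsElliptic] [W.IsGloballyMinimal]
  (K : Type) [Field K] [NumberField K]
  (Wd : WeierstrassCurve ℚ) [Wd.IsElliptic] [Wd.IsGloballyMinimal]
  (W' : WeierstrassCurve K) [W'.IsElliptic] [W'.IsGloballyMinimal]

/-- **Door L2-Q (BSD₂ form) = the cell kernel theorem read at `p = 2`.** For `W/ℚ` globally minimal
of analytic rank `≤ 1`, `K` ANY quadratic field, `Wd` a globally minimal model of the twist
`W^{(d_K)}` of analytic rank `≤ 1`, `W'` a globally minimal `K`-model of `W_K`: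
`MissingPPartOverAt W' 2 ∧ BSD(Wd, 2) ⟹ BSD(W, 2)`. Inputs of the kernel chain: Gross–Zagier–Kolyvagin
(`hGZK`), modularity (`hmod`), Milne 1972 Thm. 1 in Dokchitser–Dokchitser's quotient form (`hMilne`)
— none carries a parity hypothesis. USE (memo §2): for `E` additive at `2` and quadratically
semistabilisable, choose `K = ℚ(√(d m))` with `K ⊗ ℚ₂` the semistabilising ramified quadratic
extension of `ℚ₂` (`m ≡ 1, 5 (mod 8)`): then `W'` is SEMISTABLE at the prime `𝔭`, `𝔭² = (2)`, and
`Wd` is good or multiplicative at `2` (a customer of the cell's K4ᵒ/K4ˢ/K4ᵐ doors, or — per class —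
a PROVED class of the lane: 424 / 563). The located gap is `hK`. [folklore] -/
theorem bsdp_two_of_overK_of_twist
    (hGZK : rank_eq_analyticRank_of_analyticRank_le_one) (hmod : hasEntireLFunction_rat)
    (hMilne : Milne1972.bsdQuotient_baseChange_quadratic)
    (hr : W.analyticRank ≤ 1) (h2 : Module.finrank ℚ K = 2)
    (hWd : ∃ C : VariableChange ℚ, C • W.quadraticTwist (NumberField.discr K : ℚ) = Wd)
    (hrd : Wd.analyticRank ≤ 1)
    (hW' : ∃ C : VariableChange K, C • W.baseChange K = W')
    (hK : MissingPPartOverAt W' 2) (hd : BSDp Wd 2) : BSDp W 2 :=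
  haveI : Fact (Nat.Prime 2) := ⟨Nat.prime_two⟩
  bsdp_of_pPartOver_of_bsdp_twist' W 2 K Wd W' hGZK hmod hMilne hr h2 hWd hrd hW' hK hd

/-- The same door in Miller's `MissingPPartAt` currency of the O1 targets (`X5.O1.TwistTransportAtTwo`
is the `↔` version "NOT in print"): `MissingPPartOverAt W' 2 ∧ BSD(Wd,2) ⟹ MissingPPartAt W 2`.
[folklore] -/
theorem missingPPartAt_two_of_overK_of_twist
    (hGZK : rank_eq_analyticRank_of_analyticRank_le_one) (hmod : hasEntireLFunction_rat)
    (hMilne : Milne1972.bsdQuotient_baseChange_quadratic)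
    (hr : W.analyticRank ≤ 1) (h2 : Module.finrank ℚ K = 2)
    (hWd : ∃ C : VariableChange ℚ, C • W.quadraticTwist (NumberField.discr K : ℚ) = Wd)
    (hrd : Wd.analyticRank ≤ 1)
    (hW' : ∃ C : VariableChange K, C • W.baseChange K = W')
    (hK : MissingPPartOverAt W' 2) (hd : BSDp Wd 2) : MissingPPartAt W 2 := by
  haveI : Fact (Nat.Prime 2) := ⟨Nat.prime_two⟩
  haveI : Finite W.sha := (hGZK W hr).2
  exact missingPPartAt_of_bsdp W 2
    (bsdp_two_of_overK_of_twist W K Wd W' hGZK hmod hMilne hr h2 hWd hrd hW' hK hd)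

end DoorBSD


/-! ## §2b Door L2-Q / L2-odd, ONE-SIDED form (new, any `p`): exactness over `K` + the two UPPER
halves over `ℚ` ⟹ the `p`-part for BOTH `E` and `E^{(d_K)}` — no `BSD(Wd,p)` needed -/

section DoorPair

variable (W : WeierstrassCurve ℚ) [W.IsElliptic] (p : ℕ) [Fact p.Prime]
  (K : Type) [Field K] [NumberField K]
  (Wd : WeierstrassCurve ℚ) [Wd.IsElliptic] (W' : WeierstrassCurve K) [W'.IsElliptic]

/-- **Pair theorem (any prime `p`, any quadratic `K`).** Under the hypotheses of the identity (★)
`AdditivePotMult.shaAnOver_mul_eq` (modularity, `[K:ℚ] = 2`, `Wd` a model of `W^{(d_K)}`, `W'` a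
`K`-model of `W_K`, the three `Ш` finite, Milne's Weil-restriction identity `hWR`): if the `p`-part
of BSD holds for `W'` over `K` (`MissingPPartOverAt W' p`) and the UPPER halves
`ord_p #Ш ≤ ord_p #Ш_an` hold for `W` and for `Wd` over `ℚ`, then the `p`-part holds for BOTH `W`
and `Wd`. Proof: (★) reads `q'·#Ш(W)·#Ш(Wd) = q·q_d·#Ш(W')` in `ℚ^×`, so the `p`-adic defects
satisfy `def(W') = def(W) + def(Wd)` with `def(X) := ord_p #Ш_an(X) − ord_p #Ш(X)`; `def(W') = 0`
and `def(W), def(Wd) ≥ 0` force both to vanish. NO parity hypothesis (the odd-`p` splitting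
`#Ш(W') = #Ш(W)·#Ш(Wd)` of `Additive.padicValNat_shaOrder_eq_add_of_odd` is NOT used — at `p = 2`
it is false in general, (★) is not). USE at `p = 2` (memo §2–§3): (i) quadratic sub-class, `K`
ramified at `2`, `W'` semistable above `2`, upper halves = Kato's divisibility at `2` for `W`
(additive, lens L1) and `Wd` (good/multiplicative, doors K4); (ii) ODD CORE `Φ = C₃`: `K = k` with
`2` INERT, `W'` additive of type `C₃` at `(2)`, its `2`-part supplied by a `Δ = C₃`-equivariant
descent from a cyclic cubic `F/k` over which `E` is good above `2` (Li–Tian–Yan–Zhu 2025 §1.3 (I)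
mechanism, `#Δ` prime to `p`) — typed, not in print. [folklore] -/
theorem missingPPartAt_pair_of_over_of_upper_upper (hmod : hasEntireLFunction_rat)
    (h2 : Module.finrank ℚ K = 2)
    (hWd : ∃ C : VariableChange ℚ, C • W.quadraticTwist (NumberField.discr K : ℚ) = Wd)
    (hW' : ∃ C : VariableChange K, C • W.baseChange K = W')
    (hshaW : W.ShaFinite) (hshaD : Wd.ShaFinite) (hshaK : W'.ShaFinite)
    (hWR : (W'.shaOrder : ℝ) * W'.regulator * W'.bsdPeriod * (W'.tamagawaProduct : ℝ) /
        (W'.torsionOrder : ℝ) ^ 2 = W.bsdRHS * Wd.bsdRHS)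
    (hK : MissingPPartOverAt W' p) (hu : MissingUpperBoundAt W p)
    (hud : MissingUpperBoundAt Wd p) : MissingPPartAt W p ∧ MissingPPartAt Wd p := by
  obtain ⟨q', hq', hv'⟩ := hK
  obtain ⟨q, hq, hle⟩ := hu
  obtain ⟨qd, hqd, hled⟩ := hud
  have hstar := shaAnOver_mul_eq W K Wd W' hmod h2 hWd hW' hshaW hshaD hshaK hWR
  have hsW : W.shaOrder ≠ 0 := (W.shaOrder_pos hshaW).ne'
  have hsD : Wd.shaOrder ≠ 0 := (Wd.shaOrder_pos hshaD).ne'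
  have hsK : W'.shaOrder ≠ 0 := (W'.shaOrder_pos hshaK).ne'
  have hq0 : q ≠ 0 := by
    intro h0; apply shaAn_ne_zero W hmod; rw [hq, h0, Rat.cast_zero]
  have hqd0 : qd ≠ 0 := by
    intro h0; apply shaAn_ne_zero Wd hmod; rw [hqd, h0, Rat.cast_zero]
  -- (★) in `ℚ`
  have hQ : q' * W.shaOrder * Wd.shaOrder = q * qd * W'.shaOrder := by
    have h : ((q' * W.shaOrder * Wd.shaOrder : ℚ) : ℂ) = ((q * qd * W'.shaOrder : ℚ) : ℂ) := by
      push_cast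
      rw [← hq, ← hq', ← hqd]
      exact hstar
    exact_mod_cast h
  have hsWq : (W.shaOrder : ℚ) ≠ 0 := by exact_mod_cast hsW
  have hsDq : (Wd.shaOrder : ℚ) ≠ 0 := by exact_mod_cast hsD
  have hsKq : (W'.shaOrder : ℚ) ≠ 0 := by exact_mod_cast hsK
  have hq'0 : q' ≠ 0 := by
    intro h0
    rw [h0, zero_mul, zero_mul] at hQ
    exact mul_ne_zero (mul_ne_zero hq0 hqd0) hsKq hQ.symm
  have hv := congrArg (padicValRat p) hQ
  rw [padicValRat.mul (mul_ne_zero hq'0 hsWq) hsDq, padicValRat.mul hq'0 hsWq,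
    padicValRat.mul (mul_ne_zero hq0 hqd0) hsKq, padicValRat.mul hq0 hqd0,
    padicValRat.of_nat, padicValRat.of_nat, padicValRat.of_nat] at hv
  refine ⟨⟨q, hq, ?_⟩, ⟨qd, hqd, ?_⟩⟩
  · push_cast at hv hle hled hv' ⊢; linarith
  · push_cast at hv hle hled hv' ⊢; linarith

/-- **`p = 2`, Milne and GZK discharged: `BSD(W,2) ∧ BSD(Wd,2)` from exactness over `K` and the two
upper halves.** For `W/ℚ`, `Wd` globally minimal of analytic rank `≤ 1`, `K` any quadratic field,
`W'` a globally minimal `K`-model of `W_K`: `MissingPPartOverAt W' 2 ∧ MissingUpperBoundAt W 2 ∧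
MissingUpperBoundAt Wd 2 ⟹ BSDp W 2 ∧ BSDp Wd 2`. This is the door for the ODD CORE (`Φ = C₃`, 454
classes; `C₆` after one twist, 147) with `K` inert at `2`, and the one-sided variant of §2 for the
quadratic sub-class. [folklore] -/
theorem bsdp_two_pair_of_overK_of_upper_upper [W.IsGloballyMinimal] [Wd.IsGloballyMinimal]
    [W'.IsGloballyMinimal]
    (hGZK : rank_eq_analyticRank_of_analyticRank_le_one) (hmod : hasEntireLFunction_rat)
    (hMilne : Milne1972.bsdQuotient_baseChange_quadratic)
    (hr : W.analyticRank ≤ 1) (h2 : Module.finrank ℚ K = 2)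
    (hWd : ∃ C : VariableChange ℚ, C • W.quadraticTwist (NumberField.discr K : ℚ) = Wd)
    (hrd : Wd.analyticRank ≤ 1) (hW' : ∃ C : VariableChange K, C • W.baseChange K = W')
    (hK : MissingPPartOverAt W' 2) (hu : MissingUpperBoundAt W 2)
    (hud : MissingUpperBoundAt Wd 2) : BSDp W 2 ∧ BSDp Wd 2 := by
  haveI : Fact (Nat.Prime 2) := ⟨Nat.prime_two⟩
  obtain ⟨-, hfinW⟩ := hGZK W hr
  obtain ⟨-, hfinD⟩ := hGZK Wd hrd
  obtain ⟨hshaK, hWR⟩ := hMilne W K h2 Wd hWd W' hW' hfinW hfinD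
  obtain ⟨hW, hD⟩ := missingPPartAt_pair_of_over_of_upper_upper W 2 K Wd W' hmod h2 hWd hW' hfinW
    hfinD hshaK hWR hK hu hud
  exact ⟨bsdp_of_missingPPartAt W 2 hGZK hr hW, bsdp_of_missingPPartAt Wd 2 hGZK hrd hD⟩

end DoorPair

/-! ## §3 Doors L2-Q′ / L2-odd′, 2-CONVERSE form (new): `corank Sel_{2^∞}(E/ℚ) = r ⟹ r_an(E) = r`
from the converse over an auxiliary quadratic field with PRESCRIBED behaviour at `2` -/

section DoorConverse

variable (W : WeierstrassCurve ℚ) [W.IsElliptic]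

/-- Admissibility predicate of door L2-Q′ (quadratic sub-class): the twist `E^{(d_K)}` is good or
multiplicative at `2` — equivalently `E_K` is semistable at the prime above `2`, which then ramifies
in `K` (STEP-0 (A), j239671: true for the semistabilising `K = ℚ(√d)` on all 563 classes).
A predicate; nothing asserted. [folklore] -/
def SemistableTwistAtTwo (K : Type) [Field K] [NumberField K] : Prop :=
  Good (W.quadraticTwist (NumberField.discr K : ℚ)) 2 ∨ Mult (W.quadraticTwist (NumberField.discr K : ℚ)) 2

/-- Admissibility predicate of door L2-odd′ (odd core `Φ = C₃`): `2` is INERT in the quadratic field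
`K`, i.e. `d_K ≡ 5 (mod 8)` (so `K ⊗ ℚ₂ = ℚ₄ ∋ ζ₃` and cyclic cubic extensions `F/K` totally
ramified at `(2)` with `F_𝔓 = ℚ₄(∛2)` exist, over which a `C₃`-curve acquires good reduction).
A predicate; nothing asserted. [folklore] -/
def TwoInert (K : Type) [Field K] [NumberField K] : Prop := NumberField.discr K % 8 = 5

/-- **Typed input (b_P) — a Friedberg–Hoffstein field with prescribed behaviour `P` at `2`.** There is
a quadratic field `K` with `P K` and `L(E^{(d_K)}, 1) ≠ 0`. For `P = SemistableTwistAtTwo W`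
(resp. `TwoInert`) this is Friedberg–Hoffstein, Ann. of Math. 142 (1995) Thm. B — non-vanishing
quadratic twists with the square class prescribed at finitely many places, granted one admissible
twist of root number `+1` — applied to `E' = E^{(d)}` (resp. `E`) with the class of `m` at `2`
prescribed in `{1,5}·ℚ₂^{×2}` (resp. `5·ℚ₂^{×2}`), `χ_m` unramified at `2`; root numbers
`w(E'^{(m)}) = χ_m(−N')·w(E')` for `(m, 2N') = 1` take both signs on the admissible set (vary
`χ_m(ℓ)` at an odd `ℓ ∣ N'`, or the sign of `m`). In print modulo this bookkeeping; typed, NOT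
asserted; census: a rank-`0` PROVED partner with `N < 5·10⁵` exists for 275 / 563 quadratic classes.
[cite: FriedbergHoffstein1995, Thm. B (through BurungaleSkinnerTianWan2024, proof of Thm. 12.3, p. 96)] -/
def ExistsNonvanishingTwistWith (P : ∀ (K : Type) [Field K] [NumberField K], Prop) : Prop :=
  ∃ (K : Type) (_ : Field K) (_ : NumberField K), Module.finrank ℚ K = 2 ∧ P K ∧
    (W.quadraticTwist (NumberField.discr K : ℚ)).entireLFunction 1 ≠ 0

/-- (b₂) of door L2-Q′: a Friedberg–Hoffstein field whose twist is semistable at `2`. [folklore] -/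
abbrev ExistsSemistabilisingNonvanishingTwist : Prop :=
  ExistsNonvanishingTwistWith W (fun K _ _ => SemistableTwistAtTwo W K)

/-- **THE typed input of doors L2-Q′ / L2-odd′ — the corank-`r` 2-converse over the quadratic field
`K` for the base change `E_K`** (tree conventions: `(W.baseChange K).selmerCorank 2` and
`analyticRankEK W K = ord_{s=1} L(E,s)L(E^{(d_K)},s) = ord_{s=1} L(E_K,s)`):
`corank_{ℤ₂} Sel_{2^∞}(E/K) = r ⟹ ord_{s=1} L(E/K, s) = r`. Used ONLY for admissible `K`:
(L2-Q′) `2` ramified in `K`, `E_K` semistable (good ordinary / supersingular / multiplicative) at the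
prime above `2`; (L2-odd′) `2` inert in `K`, `E_K` additive of type `C₃` at `(2)`, the converse to
be obtained from a `Δ = C₃`-equivariant theory over a cyclic cubic `F/K` of good reduction (memo §4);
`r ∈ {0,1}`. NOTHING in print reaches either (module docstring); the nearest printed converse over an
auxiliary quadratic field, BSTW 2024 Prop. 12.10
(`burungaleSkinnerTianWan_analyticRankEK_eq_one_of_selmerCorank_eq_one`), prints `p ≠ 2`, `p` good
ordinary, `p` SPLIT in `K`; Kriz 2020v5 Thm. 10.13 (ramified, CM, unrefereed). A predicate; nothing
asserted. [folklore] -/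
def TwoConverseOverAt (K : Type) [Field K] [NumberField K] (r : ℕ) : Prop :=
  (W.baseChange K).selmerCorank 2 = r → analyticRankEK W K = r

/-- **Doors L2-Q′ / L2-odd′ (2-CONVERSE form), PROVED assembly, uniform in the admissibility
predicate `P`.** For an elliptic curve `E/ℚ` and any `r`: if (b_P) `ExistsNonvanishingTwistWith W P`,
(c) Kato's finiteness at `p = 2` (`kato_finite_of_L_one_ne_zero · 2`, Kato 2004 Cor. 14.3 — printed
for every `p`), (d) Selmer coranks add under quadratic base change (`selmerCorank_baseChange_quadratic`,
Dokchitser–Dokchitser 2010 Lemma 4.14 — any `p`), (f) modularity (`hasEntireLFunction_rat`), and the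
typed over-`K` converse `TwoConverseOverAt W K r` for every admissible `K` with non-vanishing twist,
then `corank_{ℤ₂} Sel_{2^∞}(E/ℚ) = r ⟹ r_an(E) = r`. Proof (as BSTW p. 96, minus parity): take `K`
from (b_P); by (c) `Sel_{2^∞}(E^{(d_K)}/ℚ)` is finite, of corank `0`; by (d) the corank over `K` is
`r + 0`; the over-`K` converse gives `ord L(E/K) = r`; by (f) this is `r_an(E) + r_an(E^{(d_K)}) =
r_an(E) + 0`. No parity theorem and no bound on `r` is used. [folklore] -/
theorem analyticRank_eq_of_selmerCorank_two_eq
    (P : ∀ (K : Type) [Field K] [NumberField K], Prop)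
    (hKato : ∀ (V : WeierstrassCurve ℚ) [V.IsElliptic], kato_finite_of_L_one_ne_zero V 2)
    (hbc : selmerCorank_baseChange_quadratic) (hE : hasEntireLFunction_rat)
    (hFH : ExistsNonvanishingTwistWith W P) (r : ℕ)
    (hX : ∀ (K : Type) [Field K] [NumberField K], Module.finrank ℚ K = 2 → P K →
      (W.quadraticTwist (NumberField.discr K : ℚ)).entireLFunction 1 ≠ 0 →
      TwoConverseOverAt W K r)
    (hcorank : W.selmerCorank 2 = r) : W.analyticRank = r := by
  haveI : Fact (Nat.Prime 2) := ⟨Nat.prime_two⟩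
  -- (b_P) the auxiliary quadratic field
  obtain ⟨K, _, _, h2, hP, hL1⟩ := hFH
  -- (c) Kato at `p = 2`: the `2^∞`-Selmer group of the twist is finite, hence of corank `0`
  have hd : (NumberField.discr K : ℚ) ≠ 0 := by exact_mod_cast NumberField.discr_ne_zero K
  haveI := W.isElliptic_quadraticTwist hd
  obtain ⟨-, -, hfin⟩ := hKato (W.quadraticTwist (NumberField.discr K : ℚ)) hL1
  haveI := hfin
  have h0 : (W.quadraticTwist (NumberField.discr K : ℚ)).selmerCorank 2 = 0 :=
    (W.quadraticTwist (NumberField.discr K : ℚ)).selmerCorank_eq_zero_of_finite 2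
  -- (d) the corank over `K` is `r`
  have hKr : (W.baseChange K).selmerCorank 2 = r := by
    rw [hbc W K h2 2, hcorank, h0, add_zero]
  -- (e) the typed `2`-converse over `K`
  have hEK : analyticRankEK W K = r := hX K h2 hP hL1 hKr
  -- (f) factorisation of the analytic rank over `K`
  rw [analyticRankEK_eq_add_of hE W K, analyticRank_eq_zero_of_entireLFunction_one_ne_zero _ hL1,
    add_zero] at hEK
  exact hEK

/-- **Door L2-Q′ (quadratic sub-class): the rank-0/1 2-converse as ONE implication.** Under the
printed inputs (c), (d), (f), the typed Friedberg–Hoffstein field (b₂) and the typed over-`K` converse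
in coranks `0` and `1` for quadratic `K` whose twist is semistable at `2` with `L(E^{(d_K)},1) ≠ 0`:
`corank_{ℤ₂} Sel_{2^∞}(E/ℚ) = r ≤ 1 ⟹ r_an(E) = r`. [folklore] -/
theorem twoConverse_rankLeOne_of_overK
    (hKato : ∀ (V : WeierstrassCurve ℚ) [V.IsElliptic], kato_finite_of_L_one_ne_zero V 2)
    (hbc : selmerCorank_baseChange_quadratic) (hE : hasEntireLFunction_rat)
    (hFH : ExistsSemistabilisingNonvanishingTwist W)
    (hX : ∀ (K : Type) [Field K] [NumberField K], Module.finrank ℚ K = 2 →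
      SemistableTwistAtTwo W K →
      (W.quadraticTwist (NumberField.discr K : ℚ)).entireLFunction 1 ≠ 0 →
      TwoConverseOverAt W K 0 ∧ TwoConverseOverAt W K 1)
    {r : ℕ} (hr : r ≤ 1) (hcorank : W.selmerCorank 2 = r) : W.analyticRank = r := by
  rcases Nat.le_one_iff_eq_zero_or_eq_one.mp hr with rfl | rfl
  · exact analyticRank_eq_of_selmerCorank_two_eq W (fun K _ _ => SemistableTwistAtTwo W K)
      hKato hbc hE hFH 0 (fun K _ _ h2 hP hL1 => (hX K h2 hP hL1).1) hcorank
  · exact analyticRank_eq_of_selmerCorank_two_eq W (fun K _ _ => SemistableTwistAtTwo W K)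
      hKato hbc hE hFH 1 (fun K _ _ h2 hP hL1 => (hX K h2 hP hL1).2) hcorank

/-- **Door L2-odd′ (odd core `Φ = C₃`): the same implication with `2` INERT in the auxiliary field.**
[folklore] -/
theorem twoConverse_rankLeOne_of_overInertK
    (hKato : ∀ (V : WeierstrassCurve ℚ) [V.IsElliptic], kato_finite_of_L_one_ne_zero V 2)
    (hbc : selmerCorank_baseChange_quadratic) (hE : hasEntireLFunction_rat)
    (hFH : ExistsNonvanishingTwistWith W (fun K _ _ => TwoInert K))
    (hX : ∀ (K : Type) [Field K] [NumberField K], Module.finrank ℚ K = 2 → TwoInert K →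
      (W.quadraticTwist (NumberField.discr K : ℚ)).entireLFunction 1 ≠ 0 →
      TwoConverseOverAt W K 0 ∧ TwoConverseOverAt W K 1)
    {r : ℕ} (hr : r ≤ 1) (hcorank : W.selmerCorank 2 = r) : W.analyticRank = r := by
  rcases Nat.le_one_iff_eq_zero_or_eq_one.mp hr with rfl | rfl
  · exact analyticRank_eq_of_selmerCorank_two_eq W (fun K _ _ => TwoInert K)
      hKato hbc hE hFH 0 (fun K _ _ h2 hP hL1 => (hX K h2 hP hL1).1) hcorank
  · exact analyticRank_eq_of_selmerCorank_two_eq W (fun K _ _ => TwoInert K)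
      hKato hbc hE hFH 1 (fun K _ _ h2 hP hL1 => (hX K h2 hP hL1).2) hcorank

end DoorConverse

/-! ## §4 The 2-power core `Φ ∈ {C₄, Q₈, SL₂(𝔽₃)}` (781 classes): the typed wall (no door); for the
odd core `C₃` (and `C₆` after a twist) the door is §2b/§3 with `K` inert at `2` -/

section Wall

variable (W : WeierstrassCurve ℚ) [W.IsElliptic] {F : Type*} [Field F] [NumberField F]

/-- **The wall for `Φ(E,2) ∈ {C₃, C₄, C₆, Q₈, SL₂(𝔽₃)}`, typed at output level: invariance of the
2-defect under base change to a field of good reduction.** For a number field `F` over which `E`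
acquires good reduction at every prime above `2` (for `C₃`: any cubic `F` with
`F ⊗ ℚ₂ ≅ ℚ₂(∛2)`; in general `[F_𝔭 : ℚ₂]` divisible by `#Φ / (#Φ, 2^∞·…)`, see memo §4) and a
globally minimal `F`-model `W_F` of `E_F`: `MissingPPartOverAt W_F 2 → MissingPPartAt W 2`, i.e.
"the 2-part of BSD for `E_F` over `F` gives the 2-part for `E` over `ℚ`". By Milne 1972 Thm. 1
(`BSD(Res_{F/ℚ} E_F) = BSD(E_F)`) and `Res_{F/ℚ} E_F ∼ E × A` this is EQUIVALENT, given
`BSD₂(E_F)`, to the 2-part of BSD for the complementary abelian variety `A = E ⊗ (Ind_F^ℚ 1 ⊖ 1)`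
over `ℚ` — and the CONDUCTOR BUDGET (memo §4, Lemma CB: the complementary summand of
`Ind_{F_𝔭}^{ℚ₂}(ρ_E|F_𝔭)` has Artin conductor `2·v₂(𝔡_{F_𝔭}) − f₂(E)`, which vanishes iff
`#Φ = 2` and `F_𝔭` is the semistabilising quadratic field) shows that `A` is again ADDITIVE at `2`
whenever `[F_𝔭 : ℚ₂] ≥ 3`: base change to a field of degree `≥ 3` RELOCATES the additive piece
into the complementary factor, it does not remove it — so Weil restriction ALONE yields no door for
`e ≥ 3`. For the ODD core `Φ = C₃` the additive piece is instead kept over a quadratic `k` with `2`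
inert and removed by a `Δ = C₃`-equivariant descent from a cyclic cubic `F/k` (`#Δ` odd, exact on
`2`-primary parts; Li–Tian–Yan–Zhu 2025 §1.3 (I) mechanism): doors §2b / §3 with `K = k`. For the
2-POWER core `Φ ∈ {C₄, Q₈, SL₂(𝔽₃)}` (after the tame cubic step for `SL₂(𝔽₃)` the remaining defect
group is a 2-group of order `≥ 4`) no descent group of order prime to `2` exists and this `Prop` is
the honest name of what is missing. A predicate; NOTHING asserted (Delbourgo 1998/2002: `Φ` cyclic, `#Φ ∣ p − 1`, `p` odd). [folklore] -/
def BaseChangeDefectInvarianceAt (W_F : WeierstrassCurve F) : Prop :=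
  MissingPPartOverAt W_F 2 → MissingPPartAt W 2

/-- Bookkeeping: the over-`F` 2-part together with the typed wall gives `BSD(E,2)` in analytic rank
`≤ 1` (Gross–Zagier–Kolyvagin for rank and finiteness). This is NOT a door — the second hypothesis
is the whole difficulty (see its docstring). [folklore] -/
theorem bsdp_two_of_overF_of_wall [W.IsGloballyMinimal]
    (hGZK : rank_eq_analyticRank_of_analyticRank_le_one) (hr : W.analyticRank ≤ 1)
    (W_F : WeierstrassCurve F) (hF : MissingPPartOverAt W_F 2)
    (hwall : BaseChangeDefectInvarianceAt W W_F) : BSDp W 2 :=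
  haveI : Fact (Nat.Prime 2) := ⟨Nat.prime_two⟩
  bsdp_of_missingPPartAt W 2 hGZK hr (hwall hF)

end Wall

end Summit.BirchSwinnertonDyer.Rank1Residual.X5.AddTwoL2

end
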